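import Literature.Geometry.Lorentzian.CutBondiMass
import Literature.Geometry.Lorentzian.FinalState
import HarnessLib

/-!
# The Bondi–Bartnik gap of a core of a vacuum Cauchy development
(trunk G08 = T-LORENTZ; definition request D1 of route `FinalStateConjecture/BartnikGapSettling`,
item `defn-BondiBartnikGapLE`)

Bartnik's **quasi-local mass** of a bounded region `Ω` of an initial data set is the infimum of
the ADM masses of its *admissible extensions* — asymptotically flat solutions of the constraints
(resp. of an energy condition) into which `Ω` embeds isometrically, subject to a no-horizon
condition (Bartnik, Phys. Rev. Lett. 62 (1989) 2346; Bartnik, ICM 2002, Def. 4: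
`m_QL(Ω) = inf {m_ADM(M, g) : (M, g) ∈ 𝒫ℳ(Ω)}`; Huang–Lee 2020, Def. 7.6 (admissible extension)
and Def. 7.8: `m_B(Ω₀, g₀, π₀) = inf_{(M, g, π) ∈ ℬ} m_ADM(g, π)`), together with its "space-time
generalisation", in which the region is embedded in a spacetime development and the conjectured
minimisers are stationary (Bartnik, ICM 2002, §4). Route `BartnikGapSettling` of the summit
`FinalStateConjecture` uses the following **spacetime, Bondi** variant of this functional, for a
*core* `C ⊆ M` of a vacuum Cauchy development `𝒟 = (M, g, τ, ι, ν)` (typically a point together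
with thick horizon collars on a late slice):

* a **competitor** for `C` (`VacuumCauchyDevelopment.IsCompetitor`) is a *maximal* vacuum Cauchy
  development `𝒟'` of a datum `D'` of Christodoulou's admissible class (`admissibleVacuumData`)
  together with an open `U ⊇ C` and a map `φ : M → M'` which is smooth on `U`, an open embedding
  of `U`, isometric on `U` (`φ^* g' = g` pointwise on `U`) and time-orientation preserving on `U`
  (`dφ(T)` future-directed) — Bartnik's "`Ω` embeds isometrically into `M`" with the admissible
  AF extensions replaced by MGHDs of admissible data, the region by a neighbourhood of the core;
* its **mass** (`IsCompetitorMass 𝒟 C m'`) is a Bondi energy `m'` of the cut of `𝓘⁺` generated by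
  the image core, `𝒟'.HasCutBondiMass (φ '' C) m'` (`CutBondiMass`: a limit of Hawking masses
  along an asymptotically round receding family of sections of `∂J⁺(φ '' C)`;
  Christodoulou–Klainerman 1993, Ch. 17) — the ADM mass of Bartnik's definition replaced by the
  Bondi mass of the core's own cut. No separate no-horizon clause is imposed: a core hidden behind
  a competitor's event horizon generates no receding round sections, so it has no competitor mass
  there (the request's "visibility from infinity is automatic");
* the **Bondi–Bartnik gap of `C` is at most `γ`** (`BondiBartnikGapLE 𝒟 C γ`) if for every
  competitor mass `m'` and every `η > 0` the core's own cut has a Bondi energy `m ≤ m' + γ + η` —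
  the infimum-free rendering of "`M_B(cut of C) − β_B(C) ≤ γ`", `β_B(C)` the infimum of the
  competitor masses (`bondiBartnikMass`, the `sInf` form, with the usual junk-value caveats).

This Bondi variant is **not in the printed sources**: it is the notion requested by the route
(whose cruxes `BondiBartnikRigidity`, `GapExhaustion` inline it verbatim), recorded next to
`CutBondiMass` with the locators of the definitions it is modelled on. No named facts here.

## Main definitions (`namespace Literature.Geometry.Lorentzian.VacuumCauchyDevelopment`)

* `IsCompetitor 𝒟 C 𝒟' U φ` — `(𝒟', U, φ)` is a competitor for the core `C` (structure of
  `Prop`s, fields as in the bullet above).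
* `IsCompetitorMass 𝒟 C m'` — some competitor (data manifold in the universe of `X`, Hausdorff,
  second countable, connected, as the summit statement's data manifolds) has cut Bondi energy `m'`
  at the image core.
* `BondiBartnikGapLE 𝒟 C γ` — the gap clause, stated as the curried `∀` over competitors so that
  it unfolds *definitionally* (`Iff.rfl`) to the clause inlined in the route items;
  `bondiBartnikGapLE_iff` is the readable form `∀ m', IsCompetitorMass 𝒟 C m' → ∀ η > 0, ∃ m, …`.
* `bondiBartnikMass 𝒟 C : ℝ` — `sInf {m' | IsCompetitorMass 𝒟 C m'}`, the Bondi–Bartnik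
  (quasi-local) mass `β_B(C)` of the core.

## Proved API

* `IsCompetitor.anti` (a competitor for `C'` is a competitor for every `C ⊆ C'`),
  `IsCompetitor.restrict` (shrinking the neighbourhood `U` to an open `V`, `C ⊆ V ⊆ U`),
  `isCompetitor_id` (the identity of an MGHD of admissible data competes, on any open `U ⊇ C`),
  `HasCutBondiMass.isCompetitorMass_self` (hence each of its own cut energies is a competitor
  mass — the content of the route's support item `SelfCompetitor`);
* `bondiBartnikGapLE_iff` (readable form), `BondiBartnikGapLE.mono` (monotone in `γ`),
  `bondiBartnikGapLE_of_forall_le` (a cut energy `m₀ ≤ m' + γ` for all competitor masses `m'` gives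
  gap `≤ γ`; `γ = 0`: exact minimisers), `bondiBartnikGapLE_of_forall_not` (vacuity warning:
  no competitor mass ⇒ every gap bound holds);
* `sInf` bookkeeping: `IsCompetitorMass.bondiBartnikMass_le`, `le_bondiBartnikMass`,
  `bondiBartnikMass_le_cutBondiMass` (gap `≥ 0` for MGHDs of admissible data),
  `BondiBartnikGapLE.cutBondiMass_le` (`M_B(cut) ≤ β_B(C) + γ`) and the converse
  `bondiBartnikGapLE_of_cutBondiMass_le`, each with its nonemptiness / boundedness hypotheses
  explicit.

## Design choices

* *Universe.* Competitor data manifolds range over `Type u`, the universe of the data manifold `X`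
  of `𝒟` — the discipline of `VacuumCauchyDevelopment.IsMaximal`, which quantifies over
  developments in the universe of `X`. For the summit's `X : Type` this is `X' : Type`, verbatim
  the inlined clause of the route items.
* *Curried primary form.* `BondiBartnikGapLE` is the curried `∀ X' … D' ∈ 𝒜 … 𝒟' U φ m', …` clause
  (so restating the filed items over it is `Iff.rfl`); the competitor notion is nevertheless a
  first-class predicate (`IsCompetitor`, `IsCompetitorMass`) and the two are linked by
  `bondiBartnikGapLE_iff`.
* *Frames and junk values.* `HasCutBondiMass` is frame-dependent by design (a Bondi *energy*, see
  the *Frames* paragraph of `CutBondiMass`); both the core's energies and the competitor masses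
  are therefore sets of reals, and the gap clause compares "some energy of the core" with "every
  competitor energy" up to `γ + η`. `bondiBartnikMass` is an `sInf` in `ℝ`: junk `0` when `C` has
  no competitor or the competitor masses are unbounded below (positivity of the Bondi energy,
  where known, excludes the latter); the honest statements are `IsCompetitorMass` and the lemmas
  listed above. *Vacuity:* if `C` has no competitor at all, `BondiBartnikGapLE 𝒟 C γ` holds for
  every `γ` (`bondiBartnikGapLE_of_forall_not`); if `C` has a competitor mass but no cut energy
  of its own,
  it fails for every `γ`. The route's cruxes pair the clause with `∃ m, HasCutBondiMass C m`, and
  for MGHDs of admissible data the identity competes (`isCompetitor_id`), so neither degenerate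
  case occurs there.
* *Deliberately NOT here.* Nothing about minimisers (Bartnik ICM 2002, Conj. 5, Thm. 6;
  Huang–Lee 2020, Thm. 9–10 concern ADM-mass minimisers among AF extensions, not this variant),
  no positivity, no monotonicity along nested cores — each would assert more than its source over
  `CutBondiMass`'s intrinsic round families (see that file's module docstring).

## References

* R. Bartnik, *New definition of quasilocal mass*, Phys. Rev. Lett. 62 (1989) 2346–2348.
* R. Bartnik, *Mass and 3-metrics of non-negative scalar curvature*, Proc. ICM 2002, vol. II,
  231–240 (arXiv:math/0304259), Def. 4 and §4.
* L.-H. Huang, D. A. Lee, *Bartnik mass minimizing initial data sets and improvability of the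
  dominant energy scalar*, arXiv:2007.00593, §7.2, Def. 7.6 and Def. 7.8.
* D. Christodoulou, S. Klainerman, *The global nonlinear stability of the Minkowski space*,
  Princeton Math. Series 41 (1993), Ch. 17 (Bondi mass of a cut as a limit of Hawking masses).
-/

noncomputable section

open Set Manifold Topology Filter
open scoped ContDiff

universe u

namespace Literature.Geometry.Lorentzian

variable {X : Type u} [TopologicalSpace X] [ChartedSpace E3 X] [IsManifold (𝓡 3) ∞ X]
  [ConnectedSpace X] {D : InitialDataSet (𝓡 3) X}

namespace VacuumCauchyDevelopment

section Competitor

variable {X' : Type u} [TopologicalSpace X'] [ChartedSpace E3 X'] [IsManifold (𝓡 3) ∞ X']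
  [ConnectedSpace X'] {D' : InitialDataSet (𝓡 3) X'}

/-- `(𝒟', U, φ)` is a **competitor for the core `C`** of the vacuum Cauchy development `𝒟`: `𝒟'`
is a *maximal* vacuum Cauchy development of a datum `D'` in Christodoulou's admissible class
(`admissibleVacuumData`), `U ⊇ C` is open, and `φ : M → M'` is smooth (`C^∞`) on `U`, an open
embedding of `U`, isometric on `U` (`(φ^* g')_q = g_q` for `q ∈ U`) and time-orientation
preserving on `U` (`dφ_q(T_q)` is future-directed for `𝒟'`, `T` the orienting field of `𝒟`).
This is Bartnik's "`Ω` embeds isometrically into the admissible extension `M`" (ICM 2002, Def. 4;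
Huang–Lee 2020, Def. 7.6) in the spacetime form used by route `BartnikGapSettling`: admissible AF
extensions of a region are replaced by MGHDs of admissible data receiving an isometric,
time-oriented open embedding of a neighbourhood of the core. The Bondi variant is the route's,
not the sources'. [cite: Bartnik2002ICM, Def. 4] -/
structure IsCompetitor (𝒟 : VacuumCauchyDevelopment D) (C : Set 𝒟.carrier)
    (𝒟' : VacuumCauchyDevelopment D') (U : Set 𝒟.carrier) (φ : 𝒟.carrier → 𝒟'.carrier) :
    Prop where
  /-- The competitor's datum is admissible. -/
  mem_admissibleVacuumData : D' ∈ admissibleVacuumData X'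
  /-- The competitor development is maximal (an MGHD). -/
  isMaximal : 𝒟'.IsMaximal
  /-- The neighbourhood `U` of the core is open. -/
  isOpen : IsOpen U
  /-- `U` contains the core. -/
  subset : C ⊆ U
  /-- `φ` is smooth on `U`. -/
  contMDiffOn : ContMDiffOn (𝓡 4) (𝓡 4) ∞ φ U
  /-- `φ` restricted to `U` is an open embedding. -/
  isOpenEmbedding : IsOpenEmbedding (U.restrict φ)
  /-- `φ` is isometric on `U`: `φ^* g' = g` pointwise on `U`. -/
  pullbackBilin_eq : ∀ q ∈ U,
    pullbackBilin (I := 𝓡 4) (I' := 𝓡 4) φ 𝒟'.metric.val q = 𝒟.metric.val q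
  /-- `φ` preserves the time orientation on `U`. -/
  isFutureDirected : ∀ q ∈ U, 𝒟'.timeOrientation.IsFutureDirected
    (mfderiv (𝓡 4) (𝓡 4) φ q (𝒟.timeOrientation.vectorField q))

/-- **Monotonicity in the core**: a competitor for `C'` is one for every `C ⊆ C'`. [folklore] -/
theorem IsCompetitor.anti {𝒟 : VacuumCauchyDevelopment D} {C C' : Set 𝒟.carrier}
    {𝒟' : VacuumCauchyDevelopment D'} {U : Set 𝒟.carrier} {φ : 𝒟.carrier → 𝒟'.carrier}
    (h : 𝒟.IsCompetitor C' 𝒟' U φ) (hC : C ⊆ C') : 𝒟.IsCompetitor C 𝒟' U φ :=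
  { h with subset := hC.trans h.subset }

/-- A competitor on `U` is a competitor on every open `V` with `C ⊆ V ⊆ U`. [folklore] -/
theorem IsCompetitor.restrict {𝒟 : VacuumCauchyDevelopment D} {C : Set 𝒟.carrier}
    {𝒟' : VacuumCauchyDevelopment D'} {U V : Set 𝒟.carrier} {φ : 𝒟.carrier → 𝒟'.carrier}
    (h : 𝒟.IsCompetitor C 𝒟' U φ) (hV : IsOpen V) (hCV : C ⊆ V) (hVU : V ⊆ U) :
    𝒟.IsCompetitor C 𝒟' V φ where
  mem_admissibleVacuumData := h.mem_admissibleVacuumData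
  isMaximal := h.isMaximal
  isOpen := hV
  subset := hCV
  contMDiffOn := h.contMDiffOn.mono hVU
  isOpenEmbedding := by
    have h₁ : IsOpenEmbedding (Set.inclusion hVU) :=
      { toIsEmbedding := IsEmbedding.inclusion hVU
        isOpen_range := by
          rw [Set.range_inclusion hVU]
          exact hV.preimage continuous_subtype_val }
    exact h.isOpenEmbedding.comp h₁
  pullbackBilin_eq := fun q hq ↦ h.pullbackBilin_eq q (hVU hq)
  isFutureDirected := fun q hq ↦ h.isFutureDirected q (hVU hq)

end Competitor

/-- **The identity competes.** If `𝒟` is itself a maximal vacuum Cauchy development of an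
admissible datum, then for every open `U ⊇ C` the identity `(𝒟, U, id)` is a competitor for `C`
(smooth, an open embedding of `U`, `id^* g = g`, `d(id)(T) = T` future-directed). This is the
anti-vacuity of the competitor class (route `BartnikGapSettling`, support item `SelfCompetitor`).
[folklore] -/
theorem isCompetitor_id {𝒟 : VacuumCauchyDevelopment D} (hD : D ∈ admissibleVacuumData X)
    (hmax : 𝒟.IsMaximal) {C U : Set 𝒟.carrier} (hU : IsOpen U) (hCU : C ⊆ U) :
    𝒟.IsCompetitor C 𝒟 U id where
  mem_admissibleVacuumData := hD
  isMaximal := hmax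
  isOpen := hU
  subset := hCU
  contMDiffOn := contMDiffOn_id
  isOpenEmbedding := hU.isOpenEmbedding_subtypeVal
  pullbackBilin_eq := fun q _ ↦ by rw [pullbackBilin_id]
  isFutureDirected := fun q _ ↦ by
    rw [mfderiv_id]
    exact 𝒟.timeOrientation.isFutureDirected_vectorField q

/-- **`m'` is a competitor mass of the core `C`**: there is a competitor `(𝒟', U, φ)` for `C`
(`IsCompetitor`; its data manifold `X'` in the universe of `X`, Hausdorff, second countable and
connected, as the data manifolds of the summit statement) whose cut of `𝓘⁺` generated by the image
core has Bondi energy `m'`, `𝒟'.HasCutBondiMass (φ '' C) m'` (a limit of Hawking masses along an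
asymptotically round receding family of sections of `∂J⁺(φ '' C)`, Christodoulou–Klainerman 1993,
Ch. 17). These are the numbers whose infimum is the Bondi–Bartnik mass of `C` — Bartnik's
`m_ADM(M, g)`, `(M, g) ∈ 𝒫ℳ(Ω)` (ICM 2002, Def. 4; Huang–Lee 2020, Def. 7.8) with the Bondi energy
of the core's cut in place of the ADM mass (the route's variant, not the sources').
[cite: HuangLee2020, Def. 7.8] -/
def IsCompetitorMass (𝒟 : VacuumCauchyDevelopment D) (C : Set 𝒟.carrier) (m' : ℝ) : Prop :=
  ∃ (X' : Type u) (_ : TopologicalSpace X') (_ : ChartedSpace E3 X') (_ : IsManifold (𝓡 3) ∞ X')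
    (_ : T2Space X') (_ : SecondCountableTopology X') (_ : ConnectedSpace X')
    (D' : InitialDataSet (𝓡 3) X') (𝒟' : VacuumCauchyDevelopment D') (U : Set 𝒟.carrier)
    (φ : 𝒟.carrier → 𝒟'.carrier),
    𝒟.IsCompetitor C 𝒟' U φ ∧ 𝒟'.toCauchyDevelopment.HasCutBondiMass (φ '' C) m'

/-- **The Bondi–Bartnik gap of the core `C` is at most `γ`**: for every competitor — an MGHD `𝒟'`
of an admissible datum `D'` on a (Hausdorff, second countable, connected) `3`-manifold `X'`, an
open `U ⊇ C` and `φ : M → M'` smooth on `U`, an open embedding of `U`, isometric and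
time-orientation preserving on `U` — and every Bondi energy `m'` of the cut of `𝓘⁺'` generated by
`φ '' C`, and for every `η > 0`, the cut of `𝓘⁺` generated by `C` itself has a Bondi energy
`m ≤ m' + γ + η`. This is the infimum-free form of "`M_B(cut of C) − β_B(C) ≤ γ`", `β_B` the
Bondi–Bartnik mass (`bondiBartnikMass`; `BondiBartnikGapLE.cutBondiMass_le` and
`bondiBartnikGapLE_of_cutBondiMass_le`), i.e. Bartnik's quasi-local mass (Phys. Rev. Lett. 62
(1989); ICM 2002, Def. 4; Huang–Lee 2020, Def. 7.8) with the Bondi energy of the core's own cut in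
place of the ADM mass — the route's variant, not the sources'. Stated as the curried `∀` so that
it unfolds definitionally to the clause inlined in the items `BondiBartnikRigidity`/`GapExhaustion`
of route `FinalStateConjecture/BartnikGapSettling`; the readable form over `IsCompetitorMass` is
`bondiBartnikGapLE_iff`. Competitor data manifolds range over the universe of `X`.
[cite: Bartnik2002ICM, Def. 4] -/
def BondiBartnikGapLE (𝒟 : VacuumCauchyDevelopment D) (C : Set 𝒟.carrier) (γ : ℝ) : Prop :=
  ∀ (X' : Type u) [TopologicalSpace X'] [ChartedSpace E3 X'] [IsManifold (𝓡 3) ∞ X']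
    [T2Space X'] [SecondCountableTopology X'] [ConnectedSpace X'],
    ∀ D' ∈ admissibleVacuumData X', ∀ (𝒟' : VacuumCauchyDevelopment D') (U : Set 𝒟.carrier)
      (φ : 𝒟.carrier → 𝒟'.carrier) (m' : ℝ), 𝒟'.IsMaximal → IsOpen U → C ⊆ U →
      ContMDiffOn (𝓡 4) (𝓡 4) ∞ φ U → IsOpenEmbedding (U.restrict φ) →
      (∀ q ∈ U, pullbackBilin (I := 𝓡 4) (I' := 𝓡 4) φ 𝒟'.metric.val q = 𝒟.metric.val q) →
      (∀ q ∈ U, 𝒟'.timeOrientation.IsFutureDirected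
        (mfderiv (𝓡 4) (𝓡 4) φ q (𝒟.timeOrientation.vectorField q))) →
      𝒟'.toCauchyDevelopment.HasCutBondiMass (φ '' C) m' →
      ∀ η : ℝ, 0 < η → ∃ m : ℝ, 𝒟.toCauchyDevelopment.HasCutBondiMass C m ∧ m ≤ m' + γ + η

/-- The **Bondi–Bartnik (quasi-local) mass `β_B(C)`** of the core `C`: the infimum of its
competitor masses (`IsCompetitorMass`) — Bartnik's `m_QL(Ω) = inf {m_ADM(M, g) : (M, g) ∈ 𝒫ℳ(Ω)}`
(ICM 2002, Def. 4; Huang–Lee 2020, Def. 7.8, `m_B = inf_ℬ m_ADM`) with MGHDs of admissible data as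
extensions and the Bondi energy of the image core's cut as the mass (the route's variant). An
`sInf` in `ℝ`: junk value `0` if `C` has no competitor or if the competitor masses are unbounded
below; the honest statements are `IsCompetitorMass`, `IsCompetitorMass.bondiBartnikMass_le` and
`le_bondiBartnikMass`. [cite: HuangLee2020, Def. 7.8] -/
def bondiBartnikMass (𝒟 : VacuumCauchyDevelopment D) (C : Set 𝒟.carrier) : ℝ :=
  sInf {m' | 𝒟.IsCompetitorMass C m'}

variable {𝒟 : VacuumCauchyDevelopment D} {C : Set 𝒟.carrier}

/-- **Readable form of the gap clause**: the Bondi–Bartnik gap of `C` is at most `γ` iff for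
every competitor mass `m'` of `C` and every `η > 0` the core's own cut has a Bondi energy
`m ≤ m' + γ + η`. [folklore] -/
theorem bondiBartnikGapLE_iff {γ : ℝ} :
    𝒟.BondiBartnikGapLE C γ ↔ ∀ m', 𝒟.IsCompetitorMass C m' → ∀ η : ℝ, 0 < η →
      ∃ m : ℝ, 𝒟.toCauchyDevelopment.HasCutBondiMass C m ∧ m ≤ m' + γ + η := by
  constructor
  · rintro h m' ⟨X', _, _, _, _, _, _, D', 𝒟', U, φ, hc, hm'⟩ η hη
    exact h X' D' hc.mem_admissibleVacuumData 𝒟' U φ m' hc.isMaximal hc.isOpen hc.subset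
      hc.contMDiffOn hc.isOpenEmbedding hc.pullbackBilin_eq hc.isFutureDirected hm' η hη
  · intro h X' _ _ _ _ _ _ D' hD' 𝒟' U φ m' hmax hU hCU hφ hemb hiso hfut hm' η hη
    exact h m' ⟨X', inferInstance, inferInstance, inferInstance, inferInstance, inferInstance,
      inferInstance, D', 𝒟', U, φ, ⟨hD', hmax, hU, hCU, hφ, hemb, hiso, hfut⟩, hm'⟩ η hη

/-- A competitor with cut Bondi energy `m'` at the image core witnesses the mass `m'`. [folklore] -/
theorem IsCompetitor.isCompetitorMass {X' : Type u} [TopologicalSpace X'] [ChartedSpace E3 X']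
    [IsManifold (𝓡 3) ∞ X'] [T2Space X'] [SecondCountableTopology X'] [ConnectedSpace X']
    {D' : InitialDataSet (𝓡 3) X'} {𝒟' : VacuumCauchyDevelopment D'} {U : Set 𝒟.carrier}
    {φ : 𝒟.carrier → 𝒟'.carrier} (h : 𝒟.IsCompetitor C 𝒟' U φ) {m' : ℝ}
    (hm' : 𝒟'.toCauchyDevelopment.HasCutBondiMass (φ '' C) m') : 𝒟.IsCompetitorMass C m' :=
  ⟨X', inferInstance, inferInstance, inferInstance, inferInstance, inferInstance, inferInstance,
    D', 𝒟', U, φ, h, hm'⟩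

/-- **Self-competition**: if `𝒟` is a maximal vacuum Cauchy development of an admissible datum on
a Hausdorff second countable `X`, every Bondi energy `m` of the cut generated by `C` is a
competitor mass of `C` (the identity competes, `isCompetitor_id` with `U = univ`). Hence the
Bondi–Bartnik gap is `≥ 0` (`bondiBartnikMass_le_cutBondiMass`). Route `BartnikGapSettling`,
support item `SelfCompetitor`. [folklore] -/
theorem
    _root_.Literature.Geometry.Lorentzian.CauchyDevelopment.HasCutBondiMass.isCompetitorMass_self
    [T2Space X] [SecondCountableTopology X] (hD : D ∈ admissibleVacuumData X)
    (hmax : 𝒟.IsMaximal) {m : ℝ} (hm : 𝒟.toCauchyDevelopment.HasCutBondiMass C m) :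
    𝒟.IsCompetitorMass C m :=
  (isCompetitor_id hD hmax isOpen_univ (subset_univ C)).isCompetitorMass (by rwa [Set.image_id])

/-- **Monotonicity in `γ`**: a gap bound `γ` is a gap bound `γ' ≥ γ`. [folklore] -/
theorem BondiBartnikGapLE.mono {γ γ' : ℝ} (h : 𝒟.BondiBartnikGapLE C γ) (hγ : γ ≤ γ') :
    𝒟.BondiBartnikGapLE C γ' := by
  rw [bondiBartnikGapLE_iff] at h ⊢
  intro m' hm' η hη
  obtain ⟨m, hm, hle⟩ := h m' hm' η hη
  exact ⟨m, hm, hle.trans (by linarith)⟩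

/-- **Exact and approximate minimisers**: if some Bondi energy `m₀` of the core's own cut
satisfies `m₀ ≤ m' + γ` for every competitor mass `m'`, the gap is at most `γ`; with `γ = 0`: a
core one of whose cut energies realises the infimum of its competitor masses has gap `≤ 0`.
[folklore] -/
theorem bondiBartnikGapLE_of_forall_le {γ m₀ : ℝ} (hm₀ : 𝒟.toCauchyDevelopment.HasCutBondiMass C m₀)
    (hmin : ∀ m', 𝒟.IsCompetitorMass C m' → m₀ ≤ m' + γ) : 𝒟.BondiBartnikGapLE C γ := by
  rw [bondiBartnikGapLE_iff]
  intro m' hm' η hη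
  exact ⟨m₀, hm₀, (hmin m' hm').trans (le_add_of_nonneg_right hη.le)⟩

/-- **Vacuity warning**: a core without any competitor mass satisfies every gap bound. (For MGHDs
of admissible data with a cut energy this does not happen: `isCompetitorMass_self`.) [folklore] -/
theorem bondiBartnikGapLE_of_forall_not {γ : ℝ} (h : ∀ m', ¬ 𝒟.IsCompetitorMass C m') :
    𝒟.BondiBartnikGapLE C γ := by
  rw [bondiBartnikGapLE_iff]
  exact fun m' hm' ↦ (h m' hm').elim

/-! ### The `sInf` form -/

/-- The Bondi–Bartnik mass is at most any competitor mass, provided the competitor masses are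
bounded below (e.g. by `0`, positivity of the Bondi energy). [folklore] -/
theorem IsCompetitorMass.bondiBartnikMass_le {m' : ℝ} (h : 𝒟.IsCompetitorMass C m')
    (hb : BddBelow {m' | 𝒟.IsCompetitorMass C m'}) : 𝒟.bondiBartnikMass C ≤ m' :=
  csInf_le hb h

/-- A common lower bound of the competitor masses bounds the Bondi–Bartnik mass from below,
provided `C` has a competitor mass. [folklore] -/
theorem le_bondiBartnikMass {b : ℝ} (hne : ∃ m', 𝒟.IsCompetitorMass C m')
    (hb : ∀ m', 𝒟.IsCompetitorMass C m' → b ≤ m') : b ≤ 𝒟.bondiBartnikMass C :=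
  le_csInf hne fun _ hm ↦ hb _ hm

/-- Bookkeeping: a common lower bound of the competitor masses bounds their set below. [folklore] -/
theorem bddBelow_isCompetitorMass {b : ℝ} (hb : ∀ m', 𝒟.IsCompetitorMass C m' → b ≤ m') :
    BddBelow {m' | 𝒟.IsCompetitorMass C m'} :=
  ⟨b, fun _ hm ↦ hb _ hm⟩

/-- **The gap is nonnegative** for MGHDs of admissible data: `β_B(C) ≤ M_B(cut of C)`
(`bondiBartnikMass ≤ cutBondiMass`), since each of the core's own cut energies is a competitor
mass (`isCompetitorMass_self`) — given a cut energy and competitor masses bounded below.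
[folklore] -/
theorem bondiBartnikMass_le_cutBondiMass [T2Space X] [SecondCountableTopology X]
    (hD : D ∈ admissibleVacuumData X) (hmax : 𝒟.IsMaximal)
    (hne : ∃ m, 𝒟.toCauchyDevelopment.HasCutBondiMass C m)
    (hb : BddBelow {m' | 𝒟.IsCompetitorMass C m'}) :
    𝒟.bondiBartnikMass C ≤ 𝒟.toCauchyDevelopment.cutBondiMass C :=
  le_csInf hne fun _ hm ↦ (hm.isCompetitorMass_self hD hmax).bondiBartnikMass_le hb

/-- **From the gap clause to the `sInf` inequality**: if the Bondi–Bartnik gap of `C` is at most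
`γ`, `C` has a competitor mass and the core's cut energies are bounded below, then
`M_B(cut of C) ≤ β_B(C) + γ` (`cutBondiMass ≤ bondiBartnikMass + γ`). [folklore] -/
theorem BondiBartnikGapLE.cutBondiMass_le {γ : ℝ} (h : 𝒟.BondiBartnikGapLE C γ)
    (hne : ∃ m', 𝒟.IsCompetitorMass C m')
    (hb : BddBelow {m | 𝒟.toCauchyDevelopment.HasCutBondiMass C m}) :
    𝒟.toCauchyDevelopment.cutBondiMass C ≤ 𝒟.bondiBartnikMass C + γ := by
  rw [bondiBartnikGapLE_iff] at h
  rw [← sub_le_iff_le_add]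
  refine le_csInf hne fun m' hm' ↦ ?_
  rw [sub_le_iff_le_add]
  refine le_iff_forall_pos_le_add.2 fun η hη ↦ ?_
  obtain ⟨m, hm, hle⟩ := h m' hm' η hη
  exact (csInf_le hb hm).trans hle

/-- **From the `sInf` inequality to the gap clause**: if `M_B(cut of C) ≤ β_B(C) + γ`, the core has
a cut energy and the competitor masses are bounded below, then the Bondi–Bartnik gap of `C` is at
most `γ`. [folklore] -/
theorem bondiBartnikGapLE_of_cutBondiMass_le {γ : ℝ}
    (h : 𝒟.toCauchyDevelopment.cutBondiMass C ≤ 𝒟.bondiBartnikMass C + γ)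
    (hne : ∃ m, 𝒟.toCauchyDevelopment.HasCutBondiMass C m)
    (hb : BddBelow {m' | 𝒟.IsCompetitorMass C m'}) : 𝒟.BondiBartnikGapLE C γ := by
  rw [bondiBartnikGapLE_iff]
  intro m' hm' η hη
  have hlt : sInf {m | 𝒟.toCauchyDevelopment.HasCutBondiMass C m} < m' + γ + η :=
    calc sInf {m | 𝒟.toCauchyDevelopment.HasCutBondiMass C m}
        ≤ 𝒟.bondiBartnikMass C + γ := h
      _ ≤ m' + γ := by gcongr; exact hm'.bondiBartnikMass_le hb
      _ < m' + γ + η := lt_add_of_pos_right _ hη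
  obtain ⟨m, hm, hlt'⟩ := exists_lt_of_csInf_lt hne hlt
  exact ⟨m, hm, hlt'.le⟩

/-- The gap clause and the `sInf` inequality agree whenever both infima are genuine (the core has
a cut energy, `C` has a competitor mass, both sets bounded below). [folklore] -/
theorem bondiBartnikGapLE_iff_cutBondiMass_le {γ : ℝ}
    (hne : ∃ m, 𝒟.toCauchyDevelopment.HasCutBondiMass C m)
    (hb : BddBelow {m | 𝒟.toCauchyDevelopment.HasCutBondiMass C m})
    (hne' : ∃ m', 𝒟.IsCompetitorMass C m') (hb' : BddBelow {m' | 𝒟.IsCompetitorMass C m'}) :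
    𝒟.BondiBartnikGapLE C γ ↔
      𝒟.toCauchyDevelopment.cutBondiMass C ≤ 𝒟.bondiBartnikMass C + γ :=
  ⟨fun h ↦ h.cutBondiMass_le hne' hb, fun h ↦ bondiBartnikGapLE_of_cutBondiMass_le h hne hb'⟩

end VacuumCauchyDevelopment

end Literature.Geometry.Lorentzian

end
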